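import Literature.NumberTheory.Sieve.GallagherSingularSeries
import Literature.NumberTheory.Sieve.GoldstonPintzYildirim
import HarnessLib

/-!
# Goldston–Pintz–Yıldırım, *Primes in tuples I*: discharges of the named facts

Trunk: NumberTheory / Sieve. Pure proof file (nothing defined, nothing asserted) serving the named
facts of `Literature.NumberTheory.Sieve.GoldstonPintzYildirim` (GPY 2009, §3 inputs):

* `Literature.NumberTheory.Sieve.GPY.gallagher_sum_singularSeries_holds` — DISCHARGE of `Literature.NumberTheory.Sieve.GPY.gallagher_sum_singularSeries`
  (GPY (3.7), p. 8 = Gallagher, Mathematika 23 (1976), eq. (3)) by Gallagher's theorem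
  `Literature.NumberTheory.Sieve.Gallagher.tendsto_sum_singularSeries_div_pow`, fully proved in
  `Literature.NumberTheory.Sieve.GallagherSingularSeries`; the two statements agree up to
  `Finset.image_image` (the index sets are definitionally equal — `GPY.distinctTuples k h` is the
  filter of injective maps in the cube — and propositionally
  `singularSeriesNat (univ.image t) = singularSeries (Gallagher.tupleSet t)`).
* `Literature.NumberTheory.Sieve.GPY.frequently_nth_prime_gap_lt_mul_log_of_proposition1_of_proposition2` — the GPY §3
  assembly `Literature.NumberTheory.Sieve.GPY.frequently_nth_prime_gap_lt_mul_log_of_propositions` with Gallagher's theorem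
  fed in: GPY Propositions 1 and 2 alone now imply GPY Theorem 2, (1.8)
  (`Literature.NumberTheory.Sieve.frequently_nth_prime_gap_lt_mul_log`, parity.S30).

Still undischarged on this route: `Literature.NumberTheory.Sieve.GPY.proposition1` (GPY Proposition 1, §§6–8: Lemma 1 and the
two-variable contour integral of Lemma 3; the divisor sums of Lemma 2 are proved in
`Literature.NumberTheory.Sieve.GoldstonPintzYildirimDivisorSums`) and `Literature.NumberTheory.Sieve.GPY.proposition2`
(GPY Proposition 2, §9, resting on the Bombieri–Vinogradov theorem, parity.S27).

## References

* D. A. Goldston, J. Pintz, C. Y. Yıldırım, *Primes in tuples. I*, Ann. of Math. (2) 170 (2009),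
  819–862, doi:10.4007/annals.2009.170.819 = arXiv:math/0508185, §3 (3.7) and Theorem 2 (1.8).
  [cite: GoldstonPintzYildirim2009]
* P. X. Gallagher, *On the distribution of primes in short intervals*, Mathematika 23 (1976), 4–9,
  eq. (3) p. 5. [cite: Gallagher1976]
-/

noncomputable section

open Filter Finset
open scoped Topology

namespace Literature.NumberTheory.Sieve.GPY

/-- Discharge of `Literature.NumberTheory.Sieve.GPY.gallagher_sum_singularSeries` (GPY (3.7) = Gallagher 1976, (3):
`∑_{(h₁,…,h_k) ∈ [1,h]^k distinct} 𝔖({h₁,…,h_k}) / h^k → 1` for `k ≥ 1`) by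
`Literature.NumberTheory.Sieve.Gallagher.tendsto_sum_singularSeries_div_pow` (which has no restriction on `k`).
[cite: Gallagher1976, eq. 3] -/
theorem gallagher_sum_singularSeries_holds : gallagher_sum_singularSeries := by
  intro k _
  have hmain := Literature.NumberTheory.Sieve.Gallagher.tendsto_sum_singularSeries_div_pow k
  have heq : ∀ t : Fin k → ℕ,
      singularSeriesNat (univ.image t) = singularSeries (Literature.NumberTheory.Sieve.Gallagher.tupleSet t) := by
    intro t
    rw [singularSeriesNat, Literature.NumberTheory.Sieve.Gallagher.tupleSet, Finset.image_image]
    rfl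
  simp only [heq, distinctTuples]
  exact hmain

/-- GPY Theorem 2 ((1.8): `liminf (p_{n+1} − p_n)/log p_n = 0`, as parity.S30
`Literature.NumberTheory.Sieve.frequently_nth_prime_gap_lt_mul_log`) from GPY Propositions 1 and 2 alone: the §3
assembly `frequently_nth_prime_gap_lt_mul_log_of_propositions` with its third input, Gallagher's
theorem (3.7), discharged by `gallagher_sum_singularSeries_holds`.
[cite: GoldstonPintzYildirim2009, Theorem 2 eq. 1.8 and Section 3] -/
theorem frequently_nth_prime_gap_lt_mul_log_of_proposition1_of_proposition2 (h₁ : proposition1)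
    (h₂ : proposition2) : Literature.NumberTheory.Sieve.frequently_nth_prime_gap_lt_mul_log :=
  frequently_nth_prime_gap_lt_mul_log_of_propositions h₁ h₂ gallagher_sum_singularSeries_holds

end Literature.NumberTheory.Sieve.GPY
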